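import Summits.BirchSwinnertonDyer.BirchSwinnertonDyer.Theorems.MordellShaFreeCutKatoZetaRoadLogZero
import HarnessLib

set_option linter.dupNamespace false
set_option autoImplicit false

/-! # Route `MordellShaFreeCut` (rung S2b) — crux B `AnalyticRankOneOfRankOneFiniteShaThree`
# (stmt-BirchSwinnertonDyer-19160): the NAMED research statement `LogZeroAtThreeH2` = (V₃), the annihilation
# half of Perrin-Riou's formula for Kato's zeta element of a `j = 0` curve at the ADDITIVE prime `3`, over the
# v2-pinned datum, with its two BY-NAME doors (monotone from `PRFormulaAtThreeH2`; crux B from RI7′ ∧ `LogZeroAtThreeH2`)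

Cell `bsd-cn100`, prover seat `bsd-cn100-s2b-c3` (g23, 2026-08-27), executing plan g22 RULING-1 (STATUS
2026-08-27T11:53:48Z) (3) «CONDITION — NAMED STATEMENT OBJECT»: per route ONE `@[conjecture] def` whose body is
TOKEN-IDENTICAL to the `hV` binder of the landed door `MordellShaFreeCutKatoZetaRoadLogZero.cruxB_of_registeredRI7prime_of_logZero`
(p528124 §4), plus BY NAME over the def the monotonicity theorem (ACT TEST (3c)(i)) and the RI7′-keyed door (ACT TEST
(3c)(ii)). Supports, does not close, stmt-BirchSwinnertonDyer-19160. ONE `@[conjecture] def` (the research statement,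
nothing asserted) + TWO theorems (one-line re-keyings of p528124 §1 / §4); no instance, no notation, no named fact
minted as a hypothesis. REGISTRY: untouched by this file — the registered line on 19160 is kato-zeta v1h
(5febefdcc6219422…; stubs `stub_refereedInputs` = RI7′, `stub_prFormulaAtThree : PRFormulaAtThreeH2`); the v1h → v1i
act (`stub_logZeroAtThree : LogZeroAtThreeH2`) is the PLAN's (RULING-1 (2)(vi)). The S2 twin (`LogZeroAtTwoH2` for
`congruentNumberCurve n`, `p = 2`) is seat `bsd-cn100-s2-c3`'s file.

## The statement (V₃), in words

For every globally minimal elliptic `W/ℚ` with `j(W) = 0`, every imaginary quadratic `K` with the Heegner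
hypothesis for `N = N(W)` and for `3` and with `L(W^{(d_K)}, 1) ≠ 0`, every Heegner point `P ∈ W(K)` of level `N`
which is TORSION: if `L(W, 1) = 0` then every v2-PINNED Kato descent datum `D` of `(W, 3)` (`KatoDescentDatumPinH2 W 3 D`)
satisfying Kato's Main Conjecture 12.10 in `Λ ⊗ ℚ₃` has `HasLocPKummerLog W 3 pin.katoClass 0` — the localisation
at `3` of (a non-zero multiple of) the pinned Kato class `ι[z]` is the Kummer class of a point of `ℚ₃`-logarithm `0`.
By Gross–Zagier + Kolyvagin over `K` and `L(W^{(d_K)},1) ≠ 0`, «`P` torsion» reads «`ord_{s=1} L(W,s) ≥ 3`» here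
(prose; not used formally).

## Print shape and status

(V₃) is the (⟹) half of Perrin-Riou's Conjecture 3.3.2 («`L(f,s)` a un zéro d'ordre `> 1` en `1` si et seulement
si `Tr_Λ((ω)_0) = 0`», p. 976; with Formule 3.3.4, pp. 976–977, the formula itself; stated at primes of GOOD
reduction) read in the local Kummer currency; for arbitrary `(E, p)` the shape is Burungale–Skinner–Tian–Wan's
Conj. 1.12 (a)+(b) («`log_ω(loc_p(z_E)) ≐ log_ω(P)²`; `0 ≠ P` in `E(ℚ) ⊗ ℚ` iff `ord_{s=1} L = 1`; in particular
`loc_p(z_E) ≠ 0` iff `ord = 1`»), proved by their Thm. 1.13 only for `p ∤ 2N`; Bertolini–Darmon–Venerucci's Thm. A,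
read at a torsion `P`, gives it for SEMISTABLE odd `p` only. Every `j = 0` curve is ADDITIVE at `3`: **OPEN — 0
sources at the additive prime `3`** (the cell's literature record LIT-G18 §1). (V₃) is implied by the registered
`PRFormulaAtThreeH2` (`logZeroH2_of_prFormulaH2` below, from p528124 §1) and drops from it the non-vanishing constant
`c ≠ 0` and the embedding datum `ι : K → ℚ₃`, which no consumer of the road uses; it is NOT more provable than
`PRFormulaAtThreeH2` (both halves are sourceless at additive `3`), and the converse implication is not claimed.
A third currency (Z₃) «the pinned class is ℤ-torsion» (global vanishing, Perrin-Riou 3.3.2 verbatim direction)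
implies (V₃) (`MordellShaFreeCutKatoZetaRoadZetaVanishing.logZeroAtThree_of_zetaVanishing`, p530822).

HONEST FRAMING: a NAME for a weaker research statement plus two re-keyed doors; nothing about (V₃),
`PRFormulaAtThreeH2`, the seven citation-borne inputs (RI7′), crux B, the leaf `rankOne_threeConverse_mordellCurve`,
Sylvester's problem or any case of BSD is proved here; BSD is not proved by any of this. PARTITION: none — RANK axis.
Build rule (H): concludes the route decl BY NAME through the S2b cone (`…LogZero` → `…NontrivialH1` → `…PinnedH2AtPin`
→ `…PinnedH2` → `MordellShaFreeCutOfHeegnerNonTorsion`).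

References: [PerrinRiou1993AIF] §3.3, Conj. 3.3.2 (p. 976), Formule 3.3.4 (pp. 976–977); [BurungaleSkinnerTianWan2024]
Conj. 1.12, Thm. 1.13; [BertoliniDarmonVenerucci2022] Thm. A (1)–(2); [AlpogeBhargavaShnidman2022] App. A Thm. 10.8 (a),
§10.1.2–§10.1.3 (pp. 33–34); [Kato2004Asterisque] §12.2 (12.2.2) (p. 220), Conj. 12.10 (p. 224), §14.14 (14.14.1)
(p. 243), Cor. 14.3; tree: `Theorems/MordellShaFreeCutKatoZetaRoadLogZero.lean` (p528124),
`Theorems/MordellShaFreeCutKatoZetaRoadPinnedH2.lean` (`PRFormulaAtThreeH2`), `Theorems/CongruentShaFreeCutKatoDescentDatumOfH2.lean`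
(`KatoDescentDatumPinH2`, `katoClass`), `Kato2004/LocPKummerLog.lean` (`HasLocPKummerLog`).
-/

noncomputable section

open scoped Classical

open WeierstrassCurve NumberField IsDedekindDomain Field Literature.NumberTheory.EllipticCurves
  Literature.NumberTheory.EllipticCurves.ModularForms Literature.NumberTheory.EllipticCurves.Kato2004
  Literature.NumberTheory.EllipticCurves.IwasawaAlgebra
  Literature.NumberTheory.EllipticCurves.Kato2004.EulerSystemValues
  Literature.NumberTheory.GaloisRepresentations
  Summit.BirchSwinnertonDyer.Rank1Residual.Additive
  Summit.BirchSwinnertonDyer.BirchSwinnertonDyer.Theses.MordellShaFreeCut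
  Summit.BirchSwinnertonDyer.BirchSwinnertonDyer.Theorems.CongruentShaFreeCutKatoDescentDatumOfH2
  Summit.BirchSwinnertonDyer.BirchSwinnertonDyer.Theorems.MordellShaFreeCutKatoZetaRoadPinnedH2
open Summit.BirchSwinnertonDyer.BirchSwinnertonDyer.Theorems.MordellShaFreeCutKatoZetaRoadLogZero
  (logZeroAtThree_of_prFormulaH2 cruxB_of_registeredRI7prime_of_logZero)

namespace Summit.BirchSwinnertonDyer.BirchSwinnertonDyer.Theorems.MordellShaFreeCutKatoZetaRoadLogZeroH2

/-! ## §1 The named research statement (V₃) over the v2 pin -/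

/-- **`LogZeroAtThreeH2` = (V₃) — the ANNIHILATION HALF of Perrin-Riou's formula for Kato's zeta element of a
`j = 0` curve at the ADDITIVE prime `3`, over the v2 pin** (OPEN; `@[conjecture]`, nothing asserted). For every
globally minimal elliptic `W/ℚ` with `j(W) = 0`, every imaginary quadratic `K` with the Heegner hypothesis for
`N = N(W)` and for `3` and with `L(W^{(d_K)}, 1) ≠ 0`, every Heegner point `P ∈ W(K)` of level `N` which is
TORSION: if `L(W, 1) = 0` then for every v2-PINNED Kato descent datum `D` of `(W, 3)` (`KatoDescentDatumPinH2 W 3 D`)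
satisfying Kato's Main Conjecture 12.10 in `Λ ⊗ ℚ₃` (characteristic ideals of `𝐇²` and `𝐇¹/Λz` equal up to
powers of `3`), `HasLocPKummerLog W 3 pin.katoClass 0` — the localisation at `3` of (a non-zero multiple of) the
pinned class `ι[z]` is the Kummer class of a point of logarithm `0`. Body TOKEN-IDENTICAL to the `hV` binder of
`MordellShaFreeCutKatoZetaRoadLogZero.cruxB_of_registeredRI7prime_of_logZero` (p528124 §4). PRINT SHAPE: the (⟹)
half of Perrin-Riou's Conj. 3.3.2 («zéro d'ordre `> 1` en `1` ⟺ `Tr_Λ((ω)_0) = 0`», p. 976; Formule 3.3.4,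
pp. 976–977; good reduction there), in the local Kummer currency; Burungale–Skinner–Tian–Wan Conj. 1.12 (a)+(b) for
arbitrary `(E,p)` («in particular `loc_p(z_E) ≠ 0` iff `ord_{s=1} L = 1`»; their Thm. 1.13 needs `p ∤ 2N`);
Bertolini–Darmon–Venerucci Thm. A read at a torsion `P` (semistable odd `p` only). By Gross–Zagier + Kolyvagin and
`L(W^{(d_K)},1) ≠ 0`, «`P` torsion» is «`ord_{s=1} L(W,s) ≥ 3`» here. STATUS: OPEN — 0 sources at the additive
prime `3` (every `j = 0` curve is additive at `3`). Implied by the registered `PRFormulaAtThreeH2`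
(`logZeroH2_of_prFormulaH2`), from which it drops the constant `c ≠ 0` and the embedding `ι : K → ℚ₃`; NOT more
provable than it; the converse is not claimed. The S2 twin is `CongruentShaFreeCut…LogZeroH2.LogZeroAtTwoH2`
(seat s2-c3). [cite: PerrinRiou1993AIF, §3.3, Conj. 3.3.2 (p. 976) and Formule 3.3.4 (pp. 976–977)]
[cite: BurungaleSkinnerTianWan2024, Conj. 1.12 (a)+(b) and Thm. 1.13] [cite: BertoliniDarmonVenerucci2022, Thm. A (1)–(2)]
[cite: AlpogeBhargavaShnidman2022, App. A Thm. 10.8 (a) and §10.1.3 (pp. 33–34)] -/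
@[conjecture] def LogZeroAtThreeH2 : Prop :=
  ∀ (W : WeierstrassCurve ℚ) [W.IsElliptic] [W.IsGloballyMinimal]
      [ContinuousSMul ℤ_[3] (W.tateModule 3)], W.j = 0 →
      ∀ (K : Type) [Field K] [NumberField K] (N : ℕ) [NeZero N],
        W.conductorNorm ℤ = N → IsImaginaryQuadratic K →
          SatisfiesHeegnerHypothesis N K → SatisfiesHeegnerHypothesis 3 K →
            (W.quadraticTwist (NumberField.discr K : ℚ)).entireLFunction 1 ≠ 0 →
        ∀ (P : (W.baseChange K).toAffine.Point), IsHeegnerPoint N W K P → IsOfFinAddOrder P →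
          W.entireLFunction 1 = 0 →
        ∀ (D : KatoDescentDatum 3) (pin : KatoDescentDatumPinH2 W 3 D),
          (∃ a b : ℕ,
            Ideal.span {((3 : ℕ) : IwasawaAlgebra 3) ^ a} * Module.charIdeal (IwasawaAlgebra 3) D.H2 =
              Ideal.span {((3 : ℕ) : IwasawaAlgebra 3) ^ b} *
                Module.charIdeal (IwasawaAlgebra 3) (D.H ⧸ (IwasawaAlgebra 3) ∙ D.z)) →
          HasLocPKummerLog W 3 pin.katoClass 0

/-! ## §2 The two doors BY NAME over the def -/

/-- **Monotonicity BY NAME (ACT TEST (3c)(i)): `PRFormulaAtThreeH2 → LogZeroAtThreeH2`** — the registered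
research stub implies the named weaker statement; this is p528124 §1 `logZeroAtThree_of_prFormulaH2` re-keyed to
the def (at a torsion `P`, `log_ω(P) = 0`, so Perrin-Riou's value `c · log_ω(P)²` is `0`; the constant and the
embedding are discarded). The converse is not claimed. CONDITIONAL in form; proves nothing about either statement.
[cite: PerrinRiou1993AIF, §3.3, Conj. 3.3.2 and Formule 3.3.4 (pp. 976–977)] [cite: AlpogeBhargavaShnidman2022, App. A Thm. 10.8 (a) (p. 33)] -/
theorem logZeroH2_of_prFormulaH2 : PRFormulaAtThreeH2 → LogZeroAtThreeH2 :=
  logZeroAtThree_of_prFormulaH2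

/-- **Crux B ⟸ RI7′ ∧ `LogZeroAtThreeH2`, BY NAME (ACT TEST (3c)(ii)).** The REGISTERED citation-borne stub
of the v1h line (RI7′ — 3-parity, modularity, Hoffstein–Luo, Kato finiteness, Heegner points, Gross–Zagier +
Kolyvagin, and Kato (12.2.2)'s `Kato2004.one_le_rank_iwasawaH1` — token for token the type of
`stub_refereedInputs`) together with the named research statement `LogZeroAtThreeH2` gives crux B
`AnalyticRankOneOfRankOneFiniteShaThree` BY NAME: p528124 §4 `cruxB_of_registeredRI7prime_of_logZero` re-keyed
to the def. This is the joint-sufficiency certificate of the stub pair {`stub_refereedInputs` : RI7′,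
`stub_logZeroAtThree : LogZeroAtThreeH2`} of the v1i design (plan g22 RULING-1); registering it is the plan's act,
not this file's. CONDITIONAL; closes nothing. [cite: Kato2004Asterisque, §12.2 (12.2.2) (p. 220), Cor. 14.3]
[cite: DokchitserDokchitserAnnals2010, Thm. 1.4] [cite: GrossZagier1986, Thm. I.6.3 with V.§2] [cite: Gross1984, §§3–4]
[cite: PerrinRiou1993AIF, §3.3, Conj. 3.3.2 (p. 976)] -/
theorem cruxB_of_registeredRI7prime_of_logZeroH2
    (RI : (∀ (W : WeierstrassCurve ℚ) [W.IsElliptic] (p : ℕ) [Fact p.Prime], p_parity W p) ∧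
      ModularForms.exists_isNewformOf ∧
      HoffsteinLuo1997_exists_twist_L_one_ne_zero ∧
      (∀ (W : WeierstrassCurve ℚ) [W.IsElliptic] (p : ℕ) [Fact p.Prime],
        kato_finite_of_L_one_ne_zero W p) ∧
      (∀ (W : WeierstrassCurve ℚ) (K : Type) [Field K] [NumberField K], exists_isHeegnerPoint W K) ∧
      (∀ (W : WeierstrassCurve ℚ) (N : ℕ) [NeZero N] (K : Type) [Field K] [NumberField K],
        analyticRankEK_eq_one_iff_heegner_nonTorsion W N K) ∧
      one_le_rank_iwasawaH1)
    (hV : LogZeroAtThreeH2) :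
    AnalyticRankOneOfRankOneFiniteShaThree :=
  cruxB_of_registeredRI7prime_of_logZero RI hV

end Summit.BirchSwinnertonDyer.BirchSwinnertonDyer.Theorems.MordellShaFreeCutKatoZetaRoadLogZeroH2

end
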